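import Mathlib
import HarnessLib
import Summits.Ventures.LatticeQCDFlow.Exactness.SphereFamilyLeapfrogHMCErgodic
import Summits.Ventures.LatticeQCDFlow.Exactness.SphereCapGeometry
import Summits.Ventures.LatticeQCDFlow.Exactness.GroupMetropolisLinkErgodic

/-!
# Sphere families: the uniform law charges open sets, a ball sits in every product of caps, the configuration space is preconnected

HONEST FRAMING: exact (Metropolis-corrected) sampling algorithms for lattice gauge theory;
figures of merit are autocorrelation/cost numbers at stated couplings and volumes; no
continuum-physics claim.

Venture `LatticeQCDFlow` (cell pub-lqcd), topic `Exactness`, FANOUT row 9 (eng-latcore; a leaf of the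
'update + over-relaxation' composite line for the `cpn_2d` phase space `Π i, S^{k i + 1}` —
HOME/eng-latcore/lean-sources/gen21/README.md — used by `SphereFamilyExactStep.lean`).  NEW WORK of the cell
over the tree (`SphereFamilyLeapfrog(HMC)(Ergodic).lean`: `FamS`, `FamE`, `famGibbsLaw`; `SphereCapGeometry.lean`:
`sphereCap`; `RadialPolar.lean`: `uniformSphere`; `GroupMetropolisLinkErgodic.lean`: `gibbsProbability`) and Mathlib
(`Measure.toSphere.instIsOpenPosMeasure`, `isPreconnected_sphere`, `nhdsSet_diagonal_eq_uniformity`).  Nothing is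
cited as a fact; no number is claimed.

* `isOpenPosMeasure_uniformSphere`, `famGibbsLaw_eq_gibbsProbability` (`rfl`), `continuous_angle_famCoord`,
  **`exists_ball_subset_piCap`** (`∃ ρ > 0, ∀ x y, dist y x < ρ → ∀ i, angle (x i) (y i) < r` — uniformity of the
  compact product, no trigonometry), `preconnectedSpace_famS` (each `S^{k i + 1}` is preconnected, rank `k i + 2 > 1`).

NOT CLAIMED: any quantitative constant.
-/

noncomputable section

namespace Summit.Ventures.LatticeQCDFlow.Exactness

open MeasureTheory Measure Metric Set Filter Topology Function ProbabilityTheory ProbabilityTheory.Kernel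
  InnerProductGeometry
open scoped ENNReal Uniformity

/-! ## §1 The uniform law charges open sets; a ball sits in every product of caps -/

section Caps

variable {m : Type*} [Fintype m]

/-- The uniform probability law of the sphere charges every nonempty open set (it is a nonzero multiple of
Mathlib's `volume.toSphere`, which does). -/
theorem isOpenPosMeasure_uniformSphere :
    (uniformSphere (volume : Measure (EuclideanSpace ℝ m))).IsOpenPosMeasure := by
  refine ⟨fun U hU hne => ?_⟩
  rw [uniformSphere, Measure.smul_apply, smul_eq_mul]
  exact mul_ne_zero (ENNReal.inv_ne_zero.2 (measure_ne_top _ _)) (hU.measure_ne_zero _ hne)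

variable {ι : Type*} [Fintype ι] {k : ι → ℕ}

/-- The Gibbs law of the sphere-family files IS the generic Gibbs probability over `⊗ uniformSphere`. -/
theorem famGibbsLaw_eq_gibbsProbability (S : (Π i, FamS k i) → ℝ) :
    famGibbsLaw S = gibbsProbability (Measure.pi fun i => uniformSphere (volume : Measure (FamE k i)))
      (fun x => Real.exp (-S x)) := rfl

omit [Fintype ι] in
/-- The angle at coordinate `i` is jointly continuous on pairs of configurations. -/
theorem continuous_angle_famCoord (i : ι) :
    Continuous fun p : (Π j, FamS k j) × (Π j, FamS k j) => angle (p.1 i : FamE k i) (p.2 i : FamE k i) := by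
  unfold InnerProductGeometry.angle
  have h1 : Continuous fun p : (Π j, FamS k j) × (Π j, FamS k j) => (p.1 i : FamE k i) :=
    continuous_subtype_val.comp ((continuous_apply i).comp continuous_fst)
  have h2 : Continuous fun p : (Π j, FamS k j) × (Π j, FamS k j) => (p.2 i : FamE k i) :=
    continuous_subtype_val.comp ((continuous_apply i).comp continuous_snd)
  refine Real.continuous_arccos.comp ((h1.inner h2).div ((continuous_norm.comp h1).mul (continuous_norm.comp h2))
    fun p => ?_)
  rw [norm_eq_of_mem_sphere (p.1 i), norm_eq_of_mem_sphere (p.2 i)]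
  norm_num

/-- **A BALL SITS IN EVERY PRODUCT OF CAPS, UNIFORMLY**: for `r > 0` there is `ρ > 0` with
`dist y x < ρ → angle (x i) (y i) < r` for all configurations `x, y` and all `i` (the set
`{(x, y) : ∀ i, angle (x i) (y i) < r}` is open and contains the diagonal of the compact space). -/
theorem exists_ball_subset_piCap {r : ℝ} (hr : 0 < r) :
    ∃ ρ : ℝ, 0 < ρ ∧ ∀ x y : Π i, FamS k i, dist y x < ρ →
      ∀ i, angle (x i : FamE k i) (y i : FamE k i) < r := by
  have hO : {p : (Π j, FamS k j) × (Π j, FamS k j) | ∀ i, angle (p.1 i : FamE k i) (p.2 i : FamE k i) < r} ∈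
      𝓤 (Π j, FamS k j) := by
    rw [← nhdsSet_diagonal_eq_uniformity]
    have hopen : IsOpen {p : (Π j, FamS k j) × (Π j, FamS k j) |
        ∀ i, angle (p.1 i : FamE k i) (p.2 i : FamE k i) < r} := by
      rw [show {p : (Π j, FamS k j) × (Π j, FamS k j) | ∀ i, angle (p.1 i : FamE k i) (p.2 i : FamE k i) < r} =
          ⋂ i, {p | angle (p.1 i : FamE k i) (p.2 i : FamE k i) < r} by ext p; simp only [mem_setOf_eq, mem_iInter]]
      exact isOpen_iInter_of_finite fun i => isOpen_lt (continuous_angle_famCoord i) continuous_const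
    refine hopen.mem_nhdsSet.2 ?_
    rintro ⟨x, y⟩ hxy
    rw [mem_diagonal_iff] at hxy
    simp only at hxy
    subst hxy
    intro i
    show angle (x i : FamE k i) (x i : FamE k i) < r
    rw [angle_self (ne_zero_of_mem_unit_sphere (x i))]
    exact hr
  obtain ⟨ρ, hρ, hball⟩ := Metric.mem_uniformity_dist.1 hO
  exact ⟨ρ, hρ, fun x y hyx i => hball (a := x) (b := y) (by rwa [dist_comm]) i⟩

end Caps

section Connected

variable {ι : Type*} {k : ι → ℕ}

/-- The configuration space `Π_i S^{k i + 1}` is preconnected (every sphere of dimension `≥ 1` is). -/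
theorem preconnectedSpace_famS : PreconnectedSpace (Π i, FamS k i) := by
  haveI : ∀ i, PreconnectedSpace (FamS k i) := fun i =>
    isPreconnected_iff_preconnectedSpace.1 (isPreconnected_sphere (by
      rw [← Module.finrank_eq_rank, finrank_euclideanSpace, Fintype.card_fin]
      exact_mod_cast (by omega : 1 < k i + 2)) (0 : FamE k i) 1)
  infer_instance

end Connected

end Summit.Ventures.LatticeQCDFlow.Exactness
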